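/-
Copyright: the b2b-balaban T⁴-continuum CRUX team, row NE7b leaf lineage `t4-ne7b-formalise-leaf-03` (gen 152). Project licence.
-/
import Literature.MathematicalPhysics.QuantumFieldTheory.Balaban1983to89.B5Hk165L2Zd
import Literature.MathematicalPhysics.QuantumFieldTheory.Balaban1983to89.B5Prop11Leaves
import Literature.MathematicalPhysics.QuantumFieldTheory.Balaban1983to89.B6QGQFourier275Zd

/-!
# THE ONE-SHOT SECTION IS AN η-EXPANSION: `Σ_y B(y)² ≤ ((n+1)^d)⁻¹ Σ′_z (H B)(z)²` FOR EVERY `B` (`Q′H = 1` + Jensen per block), and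
# its Fourier shadow `1 ≤ Σ_kU_k(p)R_k(p)²∕X(p)²` AT EVERY `p ∈ [−π,π]^d` (`Σ_kU_k = 1` + Cauchy–Schwarz)
# (row NE7b, node U5c; the GLOBAL floor of the η-ℓ² chart constant; [folklore]; nothing of Bałaban's)

Cell `pub-balaban`, sub-cell `t4`, spine estimate NE7b (`T4WeightBudget.RelWeightBound`; the cell's OWN estimate — NOT PRINTED in
[Bałaban 1983–89], NOT PROVED).  Crux-route work under `Spine/NE7b/` by leaf-03 (CRUX team (2), FREEZE (0) crux-prover clause, gen 152) — a
companion of this lineage's `OneShotChartFibreSharp` (`one_le_of_chart_letter` there tests only the zero mode).  NOTHING of Bałaban's is asserted;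
no `T4Continuum/Support` leaf; no `def`; zero `sorry`; Literature imports only.  Used BY NAME: `B5Hk103Unique.sum_B_kerH` ∕ `B5Hk165L2Zd.sum_B_HBZd`
(`Q′H = 1`: block sums of `H B` are `(n+1)^d B`), `B5Hk103ScalarZd.tsum_blocks` ∕ `summable_blocks`, `B5Hk165L2Zd.summable_HBZd_sq`,
`B6QGQDecay237.card_B`, `B5Prop11Leaves.sum_Ur_eq_one` (`Σ_k|u(p+2πk)|² = 1`), `B6QGQFourier275Zd.Xr_ge`, Mathlib's `sq_sum_le_card_mul_sum_sq` ∕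
`Finset.sum_mul_sq_le_sq_mul_sq`.

WHY.  The chart constants of record ((42) `(π²∕4)^d`, (44), (45), OSFU `(5∕3)^d`; this lineage's `chart_letter_iff`) are UPPER bounds ∕ the exact
supremum; the only typed LOWER information is the zero-mode floor `K ≥ 1`.  The free one-shot section is in fact an η-EXPANSION on EVERY field —
a two-line consequence of `Q′H = 1` (the block mean of `H B` on `B(y)` is `B(y)`) and Jensen (block RMS ≥ |block mean|) — and, in momentum, the
fibre ratio is `≥ 1` at EVERY `p` (equality at `p = 0`): the η-ℓ² chart can only amplify, whatever the data.

WHAT IS PROVED ([folklore]; `n : ℕ` the mesh — block side `n+1` —, `a > 0`, every `d`):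
* §1 `sum_B_HB` (block sums of `H B` on a finite window: `(n+1)^d·B(y″)·[y″ ∈ T]`), **`sq_le_sum_B_HB_sq`** (`(n+1)^d B(y″)² ≤ Σ_{z∈B(y″)}(HB)(z)²`).
* §2 **`sum_sq_le_tsum_HB_sq`** (`Σ_{y∈T}B(y)² ≤ ((n+1)^d)⁻¹Σ′_z(HB)(z)²`, finite windows), **`tsum_sq_le_tsum_HBZd_sq`** (`Σ′_yB(y)² ≤ ((n+1)^d)⁻¹Σ′_z(HB)(z)²`
  for `B ∈ ℓ²(ℤ^d)`), `one_le_of_letter_at` (no constant `< 1` in the letter tested on ANY nonzero field).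
* §3 `Xr_sq_le_sum_Ur_mul_Rr_sq` (`X² ≤ Σ_kU_kR_k²` on the zone), **`one_le_fibreRatio`** (`1 ≤ Σ_kU_kR_k²∕X²` at every `p ∈ BZ d`).

NOT HERE (honest): strictness `> 1` off the zero mode; upper bounds; other currencies; the torus; anything of Bałaban's ((A3), NC-NE7b-α UNRULED).
BY-NAME EFFECT ON THE WALL: NONE.  NE7b NOT PRINTED ∕ NOT PROVED; spine PROVED 0∕9; rung (B)+1 on a FINITE torus — NOT infinite volume, NOT the mass
gap, NOT Clay.  HONEST DEPENDENCY: continuum YM on T⁴ ⇐ BetaPertH ∧ nine spine estimates (0∕9 proved); BetaPertH ⇐ (D1) ∧ (D4) ∧ CAP+tail;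
G-an2-4 gates asym, D1 and NE2∕3∕4.
-/

set_option autoImplicit false

namespace Summit.QuantumFields.BalabanUV.T4Continuum.NE7b.OneShotChartFloor

open Finset
open Literature.MathematicalPhysics.QuantumFieldTheory.Balaban1983to89
open B4Strip (Ur Ur_nonneg)
open B4ContourShift (BZ)
open B6QGQLower276 (X B)
open B6QGQDecay237 (card_B)
open B5Hk103ScalarZd (kerH tsum_blocks)
open B5Hk103Unique (sum_B_kerH)
open B5Hk103Minimizer (HB)
open B5Hk165L2Zd (HBZd sum_B_HBZd summable_HBZd_sq)
open B5Prop11Leaves (sum_Ur_eq_one)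
open B6QGQFourier275Zd (Rr Xr Rr_nonneg)

noncomputable section

variable {d : ℕ}

/-! ## §1. Jensen on a block: the block sums of `H B` are `(n+1)^d B`, so every block carries at least `(n+1)^d B(y)²` -/

/-- **block sums of `H B` on a finite window**: `Σ_{z∈B(y″)} (Σ_{y∈T}B(y)H(z,y)) = (n+1)^d·B(y″)` for `y″ ∈ T`, `0` otherwise (`Q′H = 1`). [folklore] -/
theorem sum_B_HB (n : ℕ) {a : ℝ} (ha : 0 < a) (T : Finset (X d)) (Bf : X d → ℝ) (y'' : X d) :
    ∑ z ∈ B n y'', HB n a T Bf z = ((n : ℝ) + 1) ^ d * (if y'' ∈ T then Bf y'' else 0) := by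
  unfold HB
  rw [Finset.sum_comm]
  have h : ∀ y ∈ T, ∑ z ∈ B n y'', Bf y * kerH n a z y = Bf y * (((n : ℝ) + 1) ^ d * if y'' = y then 1 else 0) :=
    fun y _ => by rw [← Finset.mul_sum, sum_B_kerH n ha]
  rw [Finset.sum_congr rfl h]
  split_ifs with hy
  · rw [← Finset.add_sum_erase T _ hy]
    simp only [if_true]
    rw [Finset.sum_eq_zero fun y hy' => by rw [if_neg (Finset.ne_of_mem_erase hy').symm]; ring]
    ring
  · rw [Finset.sum_eq_zero fun y hy' => by
      have hne : y'' ≠ y := fun h => hy (h ▸ hy')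
      rw [if_neg hne]; ring]
    ring

/-- **JENSEN PER BLOCK**: `(n+1)^d·B(y″)² ≤ Σ_{z∈B(y″)} (HB)(z)²` for `y″ ∈ T` (Cauchy–Schwarz `(Σ_B f)² ≤ #B·Σ_B f²` and §1). [folklore] -/
theorem sq_le_sum_B_HB_sq (n : ℕ) {a : ℝ} (ha : 0 < a) (T : Finset (X d)) (Bf : X d → ℝ) {y'' : X d} (hy : y'' ∈ T) :
    ((n : ℝ) + 1) ^ d * Bf y'' ^ 2 ≤ ∑ z ∈ B n y'', HB n a T Bf z ^ 2 := by
  have hN : (0 : ℝ) < ((n : ℝ) + 1) ^ d := by positivity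
  have hcs := sq_sum_le_card_mul_sum_sq (s := B n y'') (f := fun z => HB n a T Bf z)
  rw [sum_B_HB n ha T Bf y'', if_pos hy, card_B] at hcs
  -- `((n+1)^d B)² ≤ (n+1)^d Σ (HB)²`
  have h2 : ((n : ℝ) + 1) ^ d * (((n : ℝ) + 1) ^ d * Bf y'' ^ 2) ≤ ((n : ℝ) + 1) ^ d * ∑ z ∈ B n y'', HB n a T Bf z ^ 2 := by
    calc ((n : ℝ) + 1) ^ d * (((n : ℝ) + 1) ^ d * Bf y'' ^ 2) = (((n : ℝ) + 1) ^ d * Bf y'') ^ 2 := by ring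
      _ ≤ ((n : ℝ) + 1) ^ d * ∑ z ∈ B n y'', HB n a T Bf z ^ 2 := hcs
  exact le_of_mul_le_mul_left h2 hN

/-! ## §2. THE η-ℓ² FLOOR: `‖B‖² ≤ ((n+1)^d)⁻¹ ‖H B‖²`, finite windows and square-summable fields -/

/-- **THE ONE-SHOT SECTION IS AN η-EXPANSION (finite windows)**: for every `n`, `a > 0`, every finite window `T` and field `B`,
`Σ_{y∈T} B(y)² ≤ ((n+1)^d)⁻¹ Σ′_z (Σ_{y∈T}B(y)H(z,y))²` — provided the right side converges (it does: `hS`, e.g. from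
`…OneShotChartBound.tsum_HB_sq_le_sharp`).  `Q′H = 1` and Jensen per block; no Fourier analysis. [folklore] -/
theorem sum_sq_le_tsum_HB_sq (n : ℕ) {a : ℝ} (ha : 0 < a) (T : Finset (X d)) (Bf : X d → ℝ)
    (hS : Summable fun z : X d => HB n a T Bf z ^ 2) :
    ∑ y ∈ T, Bf y ^ 2 ≤ (((n : ℝ) + 1) ^ d)⁻¹ * ∑' z : X d, HB n a T Bf z ^ 2 := by
  have hN : (0 : ℝ) < ((n : ℝ) + 1) ^ d := by positivity
  rw [le_inv_mul_iff₀ hN, ← tsum_blocks n hS, Finset.mul_sum]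
  have hblk : Summable fun y : X d => ∑ z ∈ B n y, HB n a T Bf z ^ 2 := B5Hk103ScalarZd.summable_blocks n hS
  calc ∑ y ∈ T, ((n : ℝ) + 1) ^ d * Bf y ^ 2 ≤ ∑ y ∈ T, ∑ z ∈ B n y, HB n a T Bf z ^ 2 :=
        Finset.sum_le_sum fun y hy => sq_le_sum_B_HB_sq n ha T Bf hy
    _ ≤ ∑' y : X d, ∑ z ∈ B n y, HB n a T Bf z ^ 2 :=
        hblk.sum_le_tsum T fun y _ => Finset.sum_nonneg fun z _ => sq_nonneg _

/-- **THE η-EXPANSION FOR SQUARE-SUMMABLE FIELDS**: `Σ′_y B(y)² ≤ ((n+1)^d)⁻¹ Σ′_z (H B)(z)²` for every `B ∈ ℓ²(ℤ^d)`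
(`B5Hk165L2Zd.sum_B_HBZd` + Jensen per block + `tsum_blocks`). [folklore] -/
theorem tsum_sq_le_tsum_HBZd_sq (n : ℕ) {a : ℝ} (ha : 0 < a) {Bf : X d → ℝ} (hB : Summable fun x => Bf x ^ 2) :
    ∑' y : X d, Bf y ^ 2 ≤ (((n : ℝ) + 1) ^ d)⁻¹ * ∑' z : X d, HBZd n a Bf z ^ 2 := by
  have hN : (0 : ℝ) < ((n : ℝ) + 1) ^ d := by positivity
  have hS := summable_HBZd_sq n ha hB
  rw [le_inv_mul_iff₀ hN, ← tsum_blocks n hS, ← hB.tsum_mul_left]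
  refine (hB.mul_left _).tsum_le_tsum (fun y => ?_) (B5Hk103ScalarZd.summable_blocks n hS)
  have hcs := sq_sum_le_card_mul_sum_sq (s := B n y) (f := fun z => HBZd n a Bf z)
  rw [sum_B_HBZd n ha hB y, card_B] at hcs
  have h2 : ((n : ℝ) + 1) ^ d * (((n : ℝ) + 1) ^ d * Bf y ^ 2) ≤ ((n : ℝ) + 1) ^ d * ∑ z ∈ B n y, HBZd n a Bf z ^ 2 := by
    calc ((n : ℝ) + 1) ^ d * (((n : ℝ) + 1) ^ d * Bf y ^ 2) = (((n : ℝ) + 1) ^ d * Bf y) ^ 2 := by ring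
      _ ≤ ((n : ℝ) + 1) ^ d * ∑ z ∈ B n y, HBZd n a Bf z ^ 2 := hcs
  exact le_of_mul_le_mul_left h2 hN

/-- **no constant below `1` in the η-ℓ² chart letter, tested on ANY nonzero field** (not only the constant mode). [folklore] -/
theorem one_le_of_letter_at (n : ℕ) {a : ℝ} (ha : 0 < a) (T : Finset (X d)) (Bf : X d → ℝ) {K : ℝ}
    (hS : Summable fun z : X d => HB n a T Bf z ^ 2) (hpos : 0 < ∑ y ∈ T, Bf y ^ 2)
    (h : (((n : ℝ) + 1) ^ d)⁻¹ * ∑' z : X d, HB n a T Bf z ^ 2 ≤ K * ∑ y ∈ T, Bf y ^ 2) : 1 ≤ K := by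
  have h1 := (sum_sq_le_tsum_HB_sq n ha T Bf hS).trans h
  nlinarith

/-! ## §3. The Fourier shadow: the fibre ratio is `≥ 1` at EVERY momentum of the zone -/

/-- **`X(p)² ≤ Σ_k U_k(p)R_k(p)²` on the zone** — Cauchy–Schwarz with the weights `U_k ≥ 0`, `Σ_kU_k = 1` (`B5Prop11Leaves.sum_Ur_eq_one`). [folklore] -/
theorem Xr_sq_le_sum_Ur_mul_Rr_sq (n : ℕ) (p : Fin d → ℝ) (hp : p ∈ BZ d) :
    Xr (n + 1) p ^ 2 ≤ ∑ k : Fin d → Fin (n + 1), Ur (n + 1) k p * Rr (n + 1) k p ^ 2 := by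
  have hU : ∑ k : Fin d → Fin (n + 1), Ur (n + 1) k p = 1 :=
    sum_Ur_eq_one (n + 1) (by omega) p fun μ => abs_le.mpr ⟨hp.1 μ, hp.2 μ⟩
  -- `(Σ √U·(√U R))² ≤ (Σ U)(Σ U R²)`
  have hcs := Finset.sum_mul_sq_le_sq_mul_sq (Finset.univ : Finset (Fin d → Fin (n + 1)))
    (fun k => Real.sqrt (Ur (n + 1) k p)) (fun k => Real.sqrt (Ur (n + 1) k p) * Rr (n + 1) k p)
  have h1 : ∀ k : Fin d → Fin (n + 1), Real.sqrt (Ur (n + 1) k p) * (Real.sqrt (Ur (n + 1) k p) * Rr (n + 1) k p)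
      = Ur (n + 1) k p * Rr (n + 1) k p := fun k => by
    rw [← mul_assoc, Real.mul_self_sqrt (Ur_nonneg _ _ _)]
  have h2 : ∀ k : Fin d → Fin (n + 1), Real.sqrt (Ur (n + 1) k p) ^ 2 = Ur (n + 1) k p := fun k =>
    Real.sq_sqrt (Ur_nonneg _ _ _)
  have h3 : ∀ k : Fin d → Fin (n + 1), (Real.sqrt (Ur (n + 1) k p) * Rr (n + 1) k p) ^ 2 = Ur (n + 1) k p * Rr (n + 1) k p ^ 2 :=
    fun k => by rw [mul_pow, Real.sq_sqrt (Ur_nonneg _ _ _)]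
  simp_rw [h1, h2, h3, hU, one_mul] at hcs
  unfold Xr
  exact hcs

/-- **THE FIBRE RATIO IS `≥ 1` EVERYWHERE ON THE ZONE**: `1 ≤ Σ_kU_k(p)R_k(p)²∕X(p)²` for every `p ∈ [−π,π]^d` — with this lineage's
`OneShotChartFibreSharp.chart_letter_iff` the η-ℓ² chart constant is `≥ 1` at every fibre, not only at the zero mode; equality at `p = 0`
(`…FibreSharp.fibreRatio_zero`). [folklore] -/
theorem one_le_fibreRatio (n : ℕ) (p : Fin d → ℝ) (hp : p ∈ BZ d) :
    1 ≤ (∑ k : Fin d → Fin (n + 1), Ur (n + 1) k p * Rr (n + 1) k p ^ 2) / Xr (n + 1) p ^ 2 := by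
  have hX : 0 < Xr (n + 1) p :=
    lt_of_lt_of_le (by positivity) (B6QGQFourier275Zd.Xr_ge (n + 1) (by omega) p fun μ => abs_le.mpr ⟨hp.1 μ, hp.2 μ⟩)
  rw [le_div_iff₀ (by positivity), one_mul]
  exact Xr_sq_le_sum_Ur_mul_Rr_sq n p hp

end

end Summit.QuantumFields.BalabanUV.T4Continuum.NE7b.OneShotChartFloor
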